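import HarnessLib
import Summits.Langlands.Langlands.Theses.PhantomRMYoshida
import Literature.AlgebraicGeometry.Motives.AbelianVarietyExistence
import Literature.AlgebraicGeometry.Motives.AbelianVarietyIsogenyProofs
import Literature.NumberTheory.DiophantineGeometry.AVIsogenyQuasiInverse

/-!
# `FaltingsFinitenessI` (stmt-Langlands-15084) — Negative knowledge I: the isogeny's finiteness is
# load-bearing; the quantifier-swapped statement is false

From the standing disprover's `Cruxes/FaltingsFinitenessI/Disproof.lean` (cdisprove cycle 1), unconditional
lemmas around the crux
`∀ A : AbelianVariety ℚ, ∃ n (C : Fin n → AbelianVariety ℚ), ∀ B, IsIsogenous B A → ∃ i, Nonempty (B ≅ C i)`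
(Faltings' Finiteness I over `ℚ`, a theorem in print — Faltings 1983 §6, Milne AV IV Thm 1.1 — so no
`¬`-theorem of the crux itself is expected; these lemmas fence the statement for its provers):

* `faltingsFinitenessI_false_without_isFinite` — replace "isogeny `B → A`" by "surjective homomorphism
  `B → A`" (drop `IsFinite`) and the statement is FALSE at every `A`: the projections `A × X_g → A` with
  `dim X_g = g + 1` have pairwise non-isomorphic sources. Any proof must use the finiteness of the isogeny.
* `not_finite_isoClasses_rat`, `not_faltingsFinitenessI_uniformFamily` — the quantifier swap
  `∃ n C, ∀ A B, …` is false (dimensions of abelian varieties over `ℚ` are unbounded); `n, C` depend on `A`.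
* `faltingsFinitenessI_witness_pos` — every witness list has `n ≥ 1` (`IsIsogenous.refl`).

Witnesses come from the tree's real constructions: elliptic curves and their powers as
`AbelianVariety ℚ` (`exists_abelianVariety_dim_eq_one/succ`), products (`AbelianVariety.prod`, `dim_prod`)
and invariance of `dim` under isogeny (`dim_eq_of_isIsogeny`). No statement of the route is used or
asserted. [folklore]
-/

set_option linter.dupNamespace false -- project-wide option (lakefile weak.linter.dupNamespace); `Summit.Langlands.Langlands` is the mandated namespace

open CategoryTheory AlgebraicGeometry
open Literature.AlgebraicGeometry.Motives
open Literature.AlgebraicGeometry.Motives.AbelianVariety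

namespace Summit.Langlands.Langlands.Theorems.FaltingsFinitenessI.Negative

/-! ### Helpers: `dim` is an isomorphism invariant; pigeonhole on dimensions; split epis are surjective -/

/-- An isomorphism of abelian varieties is an isogeny (its scheme map is an isomorphism, hence
surjective and finite), so it preserves `dim` (`dim_eq_of_isIsogeny`). [folklore] -/
theorem dim_eq_of_iso {A B : AbelianVariety ℚ} (e : A ≅ B) : A.dim = B.dim := by
  haveI : IsIso (Hom.toSchemeHom e.hom) :=
    ⟨Hom.toSchemeHom e.inv, by rw [← toSchemeHom_comp, e.hom_inv_id]; rfl,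
      by rw [← toSchemeHom_comp, e.inv_hom_id]; rfl⟩
  exact dim_eq_of_isIsogeny (f := e.hom) ⟨inferInstance, inferInstance⟩

/-- Pigeonhole: a family `B : ℕ → AbelianVariety ℚ` with pairwise distinct dimensions is not covered,
up to isomorphism, by any finite list `C : Fin n → AbelianVariety ℚ`. [folklore] -/
theorem not_covered_of_dim_injective (B : ℕ → AbelianVariety ℚ)
    (hB : Function.Injective fun g => (B g).dim) (n : ℕ) (C : Fin n → AbelianVariety ℚ)
    (h : ∀ g, ∃ i, Nonempty (B g ≅ C i)) : False := by
  choose f hf using h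
  refine not_injective_infinite_finite f fun g₁ g₂ hg => hB ?_
  obtain ⟨e₁⟩ := hf g₁
  obtain ⟨e₂⟩ := hf g₂
  change (B g₁).dim = (B g₂).dim
  rw [dim_eq_of_iso e₁, dim_eq_of_iso e₂, hg]

/-- A split epimorphism of abelian varieties has surjective underlying scheme map. [folklore] -/
theorem surjective_toSchemeHom_of_section {A B : AbelianVariety ℚ} (p : A ⟶ B) (s : B ⟶ A)
    (h : s ≫ p = 𝟙 B) : Surjective (Hom.toSchemeHom p) := by
  have h' : Hom.toSchemeHom s ≫ Hom.toSchemeHom p = 𝟙 B.X.left := by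
    rw [← toSchemeHom_comp, h]; rfl
  refine ⟨fun y => ⟨(Hom.toSchemeHom s).base y, ?_⟩⟩
  have := congrArg (fun q : B.X.left ⟶ B.X.left => q.base y) h'
  simpa using this

/-! ### Tightness: every witness list is nonempty -/

/-- `n = 0` never witnesses the crux at any `A`: `A` itself is isogenous to `A`
(`IsIsogenous.refl`). [folklore] -/
theorem faltingsFinitenessI_witness_pos (A : AbelianVariety ℚ) (n : ℕ) (C : Fin n → AbelianVariety ℚ)
    (h : ∀ B : AbelianVariety ℚ, IsIsogenous B A → ∃ i, Nonempty (B ≅ C i)) : 0 < n := by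
  obtain ⟨i, -⟩ := h A (IsIsogenous.refl A)
  exact i.pos

/-! ### Load-bearing: finiteness of the isogeny -/

/-- **Any proof of Finiteness I must use `IsFinite` of the isogeny.** With "isogeny" weakened to
"surjective homomorphism" the statement is false at EVERY `A : AbelianVariety ℚ`: the projections
`A × X_g → A` (`dim X_g = g + 1`, `exists_abelianVariety_dim_eq_succ`) are surjective homomorphisms
(split by `prodLift (𝟙 A) 0`) from sources of pairwise distinct dimension `dim A + g + 1` (`dim_prod`),
and dimension is an isomorphism invariant. [folklore] -/
theorem faltingsFinitenessI_false_without_isFinite :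
    ¬ ∀ A : AbelianVariety ℚ, ∃ (n : ℕ) (C : Fin n → AbelianVariety ℚ), ∀ B : AbelianVariety ℚ,
      (∃ f : B ⟶ A, Surjective (Hom.toSchemeHom f)) → ∃ i, Nonempty (B ≅ C i) := by
  intro h
  obtain ⟨A, -⟩ := exists_abelianVariety_dim_eq_one ℚ
  obtain ⟨n, C, hC⟩ := h A
  choose X hX using fun g => exists_abelianVariety_dim_eq_succ ℚ g
  refine not_covered_of_dim_injective (fun g => A.prod (X g)) ?_ n C fun g => hC _ ⟨fst A (X g), ?_⟩
  · intro g₁ g₂ hg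
    change (A.prod (X g₁)).dim = (A.prod (X g₂)).dim at hg
    rw [dim_prod, dim_prod, hX, hX] at hg
    omega
  · exact surjective_toSchemeHom_of_section _ (prodLift (𝟙 A) 0) (prodLift_fst _ _)

/-! ### The quantifier-swapped statement is false -/

/-- There are NOT finitely many abelian varieties over `ℚ` up to isomorphism: dimensions are
unbounded (`exists_abelianVariety_dim_eq_succ`) and `dim` is an isomorphism invariant. [folklore] -/
theorem not_finite_isoClasses_rat :
    ¬ ∃ (n : ℕ) (C : Fin n → AbelianVariety ℚ), ∀ A : AbelianVariety ℚ, ∃ i, Nonempty (A ≅ C i) := by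
  rintro ⟨n, C, hC⟩
  choose X hX using fun g => exists_abelianVariety_dim_eq_succ ℚ g
  refine not_covered_of_dim_injective X ?_ n C fun g => hC (X g)
  intro g₁ g₂ hg
  change (X g₁).dim = (X g₂).dim at hg
  rw [hX, hX] at hg
  omega

/-- **The quantifier-swapped crux is false**: no single finite list `C` serves every isogeny class
(`∃ n C, ∀ A B, IsIsogenous B A → ∃ i, B ≅ C i` fails: take `B = A`, `IsIsogenous.refl`, and
`not_finite_isoClasses_rat`). In the crux, `n` and `C` genuinely depend on `A`. [folklore] -/
theorem not_faltingsFinitenessI_uniformFamily :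
    ¬ ∃ (n : ℕ) (C : Fin n → AbelianVariety ℚ), ∀ A B : AbelianVariety ℚ,
      IsIsogenous B A → ∃ i, Nonempty (B ≅ C i) := by
  rintro ⟨n, C, hC⟩
  exact not_finite_isoClasses_rat ⟨n, C, fun A => hC A A (IsIsogenous.refl A)⟩

end Summit.Langlands.Langlands.Theorems.FaltingsFinitenessI.Negative
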